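import Summits.NavierStokesRegularity.NavierStokesRegularity.Theorems.ScenarioCensusFarfieldMeter
import HarnessLib

/-!
# LINE «farfield-meter» port, part 2/2: §E the census rows in the (L′)-shape, verdicts, nestings (incl. `row_A2ff0_imp_envelope`), controls; census KEYS `Row_A2ffC` /
# `Row_A2ffP` + `_excluded`, `Row_A2ff0` / `Row_A2ff1` / `Row_A2ffQ` / `Row_A2ffW` (OPEN, pairwise equivalent)

Re-homed for the scenario census (typer seat ns-census-typer-1 g9; the cells A2ffC / A2ffP are MEMBERS OF RECORD «PROVED EMPTY IN KERNEL IN FILES» of block A2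
since census v1.94 (critic idea-crit-3 g8 PASS 07:37:30Z — no price; ref ns-census-ref g12 PRE-CHECK ✓ §17.7 item 62; lead-presearch label item 62); this port
makes them TREE-decided): VERBATIM PORT of ns-idea-2 LINE g16-1 «farfield-meter», `pub/ideators/ns-idea-2/lines/farfield-meter/line-farfield-meter.lean` sha16
3f153089dab25607 (410 l., lean check rc 0, 0 sorry), split for the 400-line rule into `ScenarioCensusFarfieldMeter` (§A–§D) → `…FarfieldMeterRows` (§E + census
KEYS).  Lean text VERBATIM in namespace `…Theorems.ScenarioCensus.FarfieldMeter` (the line's `…Lines.FarfieldMeter` re-homed); port edits: `local notation "E3"`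
→ `abbrev E3` (typer lint: no notation in port files), `set_option linter.unusedVariables false` dropped (ref §17.7: a port must drop it; the tree builds with 0
warnings), `@[conjecture]` on the OPEN rows `Row_A2ff0` / `Row_A2ff1` / `Row_A2ffQ` / `Row_A2ffW` (typed only).  Statements untouched.

No census VALUE is moved here (the cells become TREE-decided by name; booking is the lead's); NS regularity is NOT proved; (L′) ⟨10661⟩ is untouched; no
summit statement is proved by this file.
-/

-- the summit and its single problem share the name `NavierStokesRegularity` (D-0017 nested layout)
set_option linter.dupNamespace false

noncomputable section

open Set Function Filter
open scoped Topology
open Literature.Analysis.FluidPDE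
open Summit.NavierStokesRegularity.NavierStokesRegularity.Theorems
open Summit.NavierStokesRegularity.NavierStokesRegularity.Theorems.SymmetryModuliCountSymmetricLiouville
open Summit.NavierStokesRegularity.NavierStokesRegularity.Theorems.NearExtremalTransiencePerFlow.FilamentSelection
open Summit.NavierStokesRegularity.NavierStokesRegularity.Theorems.SimilarityEnstrophy

namespace Summit.NavierStokesRegularity.NavierStokesRegularity.Theorems.ScenarioCensus.FarfieldMeter

/-! ## E. Census rows in the (L′)-shape -/

/-- `Row_A2ffC` — NONZERO CONSTANT FAR-FIELD LIMIT at one instant: `u(t₀, x) → c ≠ 0` uniformly as `‖x‖ → ∞`.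
EXCLUDED (the cell is empty: `farLimit_eq_zero`). -/
def Row_A2ffC : Prop :=
  ∀ (C : ℝ) (u : ℝ → E3 → E3), IsTypeIAncientMild C u →
    (∃ t₀ : ℝ, t₀ < 0 ∧ ∃ c : E3, c ≠ 0 ∧ Decays (fun x => u t₀ x - c)) →
    ∀ t < 0, ∀ x, u t x = 0

/-- `Row_A2ffP` — NONZERO PERIODIC FAR-FIELD PATTERN at one instant: `u(t₀,·)` is asymptotic at infinity to a
pattern `w`, periodic in a direction `e ≠ 0` and not identically zero. EXCLUDED (`pattern_eq_zero`). -/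
def Row_A2ffP : Prop :=
  ∀ (C : ℝ) (u : ℝ → E3 → E3), IsTypeIAncientMild C u →
    (∃ t₀ : ℝ, t₀ < 0 ∧ ∃ e : E3, e ≠ 0 ∧ ∃ w : E3 → E3,
      (∀ x, w (x + e) = w x) ∧ (∃ x, w x ≠ 0) ∧ Decays (fun x => u t₀ x - w x)) →
    ∀ t < 0, ∀ x, u t x = 0

/-- `Row_A2ff0` — SILENT FAR FIELD: every slice decays at spatial infinity (no rate). OPEN (the honest cell:
spatially localised Type-I ancient profiles). -/
@[conjecture] def Row_A2ff0 : Prop :=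
  ∀ (C : ℝ) (u : ℝ → E3 → E3), IsTypeIAncientMild C u → (∀ t < 0, Decays (u t)) →
    ∀ t < 0, ∀ x, u t x = 0

/-- `Row_A2ff1` — ONE decaying slice. OPEN; `↔ Row_A2ff0` (silence is eternal). -/
@[conjecture] def Row_A2ff1 : Prop :=
  ∀ (C : ℝ) (u : ℝ → E3 → E3), IsTypeIAncientMild C u → (∃ t₀ : ℝ, t₀ < 0 ∧ Decays (u t₀)) →
    ∀ t < 0, ∀ x, u t x = 0

/-- `Row_A2ffQ` — QUIET FAR FIELD: for some `θ < 1`, at every instant the scaled amplitude `√(−t)‖u(t,x)‖` is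
`≤ θ` beyond some radius. OPEN; `↔ Row_A2ff0` (the far-field gap). -/
@[conjecture] def Row_A2ffQ : Prop :=
  ∀ (C : ℝ) (u : ℝ → E3 → E3), IsTypeIAncientMild C u → (∃ θ : ℝ, θ < 1 ∧ FarQuiet θ u) →
    ∀ t < 0, ∀ x, u t x = 0

/-- `Row_A2ffW` — ONE slice ASYMPTOTICALLY PERIODIC (pattern periodic in some direction, allowed to vanish).
OPEN; `↔ Row_A2ff1` (patterns are silent). -/
@[conjecture] def Row_A2ffW : Prop :=
  ∀ (C : ℝ) (u : ℝ → E3 → E3), IsTypeIAncientMild C u →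
    (∃ t₀ : ℝ, t₀ < 0 ∧ ∃ e : E3, e ≠ 0 ∧ ∃ w : E3 → E3,
      (∀ x, w (x + e) = w x) ∧ Decays (fun x => u t₀ x - w x)) →
    ∀ t < 0, ∀ x, u t x = 0

/-! ### Verdicts -/

/-- `Row_A2ffC` is EXCLUDED: PROVED (vacuously — the far-field limit is `0`). -/
theorem row_A2ffC : Row_A2ffC := by
  intro C u hu ⟨t₀, ht₀, c, hc, ha⟩
  exact absurd (farLimit_eq_zero hu ht₀ ha) hc

/-- `Row_A2ffP` is EXCLUDED: PROVED (the pattern vanishes identically). -/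
theorem row_A2ffP : Row_A2ffP := by
  intro C u hu ⟨t₀, ht₀, e, he, w, hw, ⟨x, hx⟩, ha⟩
  exact absurd (pattern_eq_zero hu ht₀ he hw ha x) hx

/-- `Row_A2ff1 ↔ Row_A2ff0`: PROVED (silence is eternal). -/
theorem row_A2ff1_iff_A2ff0 : Row_A2ff1 ↔ Row_A2ff0 := by
  refine ⟨fun h C u hu hd => h C u hu ⟨-1, by norm_num, hd (-1) (by norm_num)⟩, fun h C u hu ⟨t₀, ht₀, hd⟩ => ?_⟩
  exact h C u hu (decays_of_decays_slice hu ht₀ hd)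

/-- `Row_A2ffQ ↔ Row_A2ff0`: PROVED (the far-field gap; a silent far field is quiet at level `0`). -/
theorem row_A2ffQ_iff_A2ff0 : Row_A2ffQ ↔ Row_A2ff0 := by
  refine ⟨fun h C u hu hd => h C u hu ⟨1 / 2, by norm_num, fun t ht => ?_⟩,
    fun h C u hu ⟨θ, hθ, hq⟩ => h C u hu (decays_of_farQuiet hu hθ hq)⟩
  have hst : 0 < Real.sqrt (-t) := Real.sqrt_pos.2 (by linarith)
  obtain ⟨R, hR⟩ := hd t ht (1 / 2 / Real.sqrt (-t)) (by positivity)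
  refine ⟨R, fun x hx => ?_⟩
  have := hR x hx
  rwa [le_div_iff₀ hst, mul_comm] at this

/-- `Row_A2ffW ↔ Row_A2ff1`: PROVED (an asymptotic periodic pattern vanishes, so the slice decays; a
decaying slice is asymptotic to the zero pattern). -/
theorem row_A2ffW_iff_A2ff1 : Row_A2ffW ↔ Row_A2ff1 := by
  refine ⟨fun h C u hu ⟨t₀, ht₀, hd⟩ => ?_, fun h C u hu ⟨t₀, ht₀, e, he, w, hw, ha⟩ =>
    h C u hu ⟨t₀, ht₀, decays_of_asymptotic_pattern hu ht₀ he hw ha⟩⟩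
  exact h C u hu ⟨t₀, ht₀, _, single_ne_zero, fun _ => 0, fun _ => rfl, by simpa using hd⟩

/-- Nesting: `Row_A2ffC` is a sub-cell of `Row_A2ffP` (constants are periodic in every direction). PROVED. -/
theorem row_A2ffP_imp_A2ffC : Row_A2ffP → Row_A2ffC := by
  intro h C u hu ⟨t₀, ht₀, c, hc, ha⟩
  exact h C u hu ⟨t₀, ht₀, _, single_ne_zero, fun _ => c, fun _ => rfl, ⟨0, hc⟩, ha⟩

/-- Nesting to the tree's space–time ENVELOPE class (census A2, `HasTypeIDecay C₀ u`:
`‖u(t,x)‖ ≤ C₀/(‖x‖ + √(−t))`): envelope elements have silent far fields, so `Row_A2ff0` implies the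
envelope cell. PROVED. -/
theorem row_A2ff0_imp_envelope (h : Row_A2ff0) :
    ∀ (C C₀ : ℝ) (u : ℝ → E3 → E3), IsTypeIAncientMild C u → HasTypeIDecay C₀ u →
      ∀ t < 0, ∀ x, u t x = 0 := by
  intro C C₀ u hu hdec
  refine h C u hu fun t ht ε hε => ?_
  have hst : 0 < Real.sqrt (-t) := Real.sqrt_pos.2 (by linarith)
  have hC₀ : 0 ≤ C₀ := by
    have h0 := hdec t ht 0
    have : (0 : ℝ) ≤ C₀ / (‖(0 : E3)‖ + Real.sqrt (-t)) := (norm_nonneg _).trans h0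
    rw [norm_zero, zero_add] at this
    exact (div_nonneg_iff.1 this).elim (fun h => h.1) fun h => absurd h.2 (not_le.2 hst)
  refine ⟨C₀ / ε, fun x hx => ?_⟩
  have hpos : 0 < ‖x‖ + Real.sqrt (-t) := by positivity
  refine (hdec t ht x).trans ?_
  rw [div_le_iff₀ hpos]
  have h1 : C₀ ≤ ε * ‖x‖ := by rwa [div_le_iff₀' hε] at hx
  nlinarith [hst.le, hε.le]

/-- Every row follows from (L′) (`TypeIAncientLiouville` over the class, bridge
`isTypeIAncientMild_iff`). PROVED. -/
theorem rows_of_L' (hL : ∀ (C : ℝ) (u : ℝ → E3 → E3), IsTypeIAncientMild C u → ∀ t < 0, ∀ x, u t x = 0) :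
    Row_A2ffC ∧ Row_A2ffP ∧ Row_A2ff0 ∧ Row_A2ff1 ∧ Row_A2ffQ ∧ Row_A2ffW :=
  ⟨fun C u hu _ => hL C u hu, fun C u hu _ => hL C u hu, fun C u hu _ => hL C u hu,
    fun C u hu _ => hL C u hu, fun C u hu _ => hL C u hu, fun C u hu _ => hL C u hu⟩

/-- Bridge to the rung (L′) BY NAME: `Theses.SymmetryModuliCount.TypeIAncientLiouville` ⟨stmt-10661⟩
implies every row. PROVED. -/
theorem rows_of_rung (hL : Theses.SymmetryModuliCount.TypeIAncientLiouville) :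
    Row_A2ffC ∧ Row_A2ffP ∧ Row_A2ff0 ∧ Row_A2ff1 ∧ Row_A2ffQ ∧ Row_A2ffW :=
  rows_of_L' fun C u hu => hL C u (isTypeIAncientMild_iff.1 hu)

/-! ### Controls (the class is load-bearing; the predicates are not vacuous) -/

/-- Control: the zero field has a silent far field. -/
theorem control_decays_zero : ∀ t : ℝ, t < 0 → Decays ((0 : ℝ → E3 → E3) t) :=
  fun t _ ε hε => ⟨0, fun x _ => by simpa using hε.le⟩

/-- Control: a nonzero constant field does NOT decay (so `Decays` is a genuine restriction; constants are
excluded from `A_C` only by the class, `eq_zero_of_const_slice`). -/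
theorem control_const_not_decays {c : E3} (hc : c ≠ 0) : ¬ Decays (fun _ : E3 => c) := by
  intro h
  have hc' : 0 < ‖c‖ := norm_pos_iff.2 hc
  obtain ⟨R, hR⟩ := h (‖c‖ / 2) (by positivity)
  obtain ⟨x, hx⟩ : ∃ x : E3, R ≤ ‖x‖ := by
    obtain ⟨n, hn⟩ := exists_nat_ge R
    refine ⟨(n : ℝ) • EuclideanSpace.single 0 1, ?_⟩
    simpa [norm_smul] using hn
  have := hR x hx
  linarith

end Summit.NavierStokesRegularity.NavierStokesRegularity.Theorems.ScenarioCensus.FarfieldMeter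

namespace Summit.NavierStokesRegularity.NavierStokesRegularity.Theorems.ScenarioCensus

/-! ## Census KEYS (ns `…Theorems.ScenarioCensus`): instrument FARFIELD METER (block A2) — TREE-decided (empty) cells A2ffC / A2ffP, OPEN rows A2ff0 ⇔ A2ff1 ⇔ A2ffQ ⇔ A2ffW -/

/-- **Cell A2ffC** (NONZERO CONSTANT FAR-FIELD LIMIT at one instant ⇒ `u ≡ 0`; the cell is EMPTY: the limit is `0`): `:= FarfieldMeter.Row_A2ffC`. DECIDED. -/
def Row_A2ffC : Prop := FarfieldMeter.Row_A2ffC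
/-- A2ffC is EXCLUDED (decided in the tree): `FarfieldMeter.row_A2ffC`. -/
theorem row_A2ffC_excluded : Row_A2ffC := FarfieldMeter.row_A2ffC

/-- **Cell A2ffP** (NONZERO PERIODIC FAR-FIELD PATTERN at one instant ⇒ `u ≡ 0`; the pattern vanishes): `:= FarfieldMeter.Row_A2ffP`. DECIDED. -/
def Row_A2ffP : Prop := FarfieldMeter.Row_A2ffP
/-- A2ffP is EXCLUDED (decided in the tree): `FarfieldMeter.row_A2ffP`. -/
theorem row_A2ffP_excluded : Row_A2ffP := FarfieldMeter.row_A2ffP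

/-- **Row A2ff0** (SILENT FAR FIELD: every slice decays at spatial infinity, no rate) — typed only: `:= FarfieldMeter.Row_A2ff0`. OPEN (no witness, no proof). -/
@[conjecture] def Row_A2ff0 : Prop := FarfieldMeter.Row_A2ff0

/-- **Row A2ff1** (ONE decaying slice; `↔ Row_A2ff0`) — typed only: `:= FarfieldMeter.Row_A2ff1`. OPEN. -/
@[conjecture] def Row_A2ff1 : Prop := FarfieldMeter.Row_A2ff1

/-- **Row A2ffQ** (QUIET FAR FIELD at some level `θ < 1`; `↔ Row_A2ff0`) — typed only: `:= FarfieldMeter.Row_A2ffQ`. OPEN. -/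
@[conjecture] def Row_A2ffQ : Prop := FarfieldMeter.Row_A2ffQ

/-- **Row A2ffW** (ONE asymptotically periodic slice, pattern may vanish; `↔ Row_A2ff1`) — typed only: `:= FarfieldMeter.Row_A2ffW`. OPEN. -/
@[conjecture] def Row_A2ffW : Prop := FarfieldMeter.Row_A2ffW

/-- Lattice edges at key level: A2ffP → A2ffC (`FarfieldMeter.row_A2ffP_imp_A2ffC`); A2ff1 ↔ A2ff0, A2ffQ ↔ A2ff0, A2ffW ↔ A2ff1 (`…_iff_…`). -/
theorem row_A2ffC_of_row_A2ffP : Row_A2ffP → Row_A2ffC := FarfieldMeter.row_A2ffP_imp_A2ffC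
/-- See `row_A2ffC_of_row_A2ffP`. -/
theorem row_A2ff0_of_row_A2ff1 : Row_A2ff1 → Row_A2ff0 := FarfieldMeter.row_A2ff1_iff_A2ff0.1
/-- See `row_A2ffC_of_row_A2ffP`. -/
theorem row_A2ff1_of_row_A2ff0 : Row_A2ff0 → Row_A2ff1 := FarfieldMeter.row_A2ff1_iff_A2ff0.2
/-- See `row_A2ffC_of_row_A2ffP`. -/
theorem row_A2ff0_of_row_A2ffQ : Row_A2ffQ → Row_A2ff0 := FarfieldMeter.row_A2ffQ_iff_A2ff0.1
/-- See `row_A2ffC_of_row_A2ffP`. -/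
theorem row_A2ffQ_of_row_A2ff0 : Row_A2ff0 → Row_A2ffQ := FarfieldMeter.row_A2ffQ_iff_A2ff0.2
/-- See `row_A2ffC_of_row_A2ffP`. -/
theorem row_A2ff1_of_row_A2ffW : Row_A2ffW → Row_A2ff1 := FarfieldMeter.row_A2ffW_iff_A2ff1.1
/-- See `row_A2ffC_of_row_A2ffP`. -/
theorem row_A2ffW_of_row_A2ff1 : Row_A2ff1 → Row_A2ffW := FarfieldMeter.row_A2ffW_iff_A2ff1.2

end Summit.NavierStokesRegularity.NavierStokesRegularity.Theorems.ScenarioCensus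

end
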